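import Literature.NumberTheory.LFunctions.ClassicalZeroFreeRegion
import Mathlib.Analysis.InnerProductSpace.Calculus
import Mathlib.Analysis.Calculus.MeanValue
import HarnessLib

/-!
# `1/ζ ≪ log(|t| + 4)` in the classical region, for an abstract `ClassicalZFRData` (MV Theorem 6.7)

Topic `Literature/NumberTheory/LFunctions`. Everything in this file is PROVED (no definitions, no named
facts). Companion of `ClassicalZeroFreeRegion.lean`, which axiomatises the de la Vallée-Poussin–Landau
argument for a pair `(Λ, G)` (`Literature.NumberTheory.LFunctions.ClassicalZFRData Λ G η`; models
`G(s) = (s − 1)ζ(s)` and `G(s) = (s − 1)ζ_K(s)`) and proves there the zero-free region (`zeroFree`,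
MV Theorem 6.6) and `G'/G ≪ log(|t| + 4)` (`norm_logDeriv_le`, the first estimate of MV Theorem 6.7
(6.6)). Here we add the SECOND estimate of Montgomery–Vaughan, *Multiplicative Number Theory I*,
Theorem 6.7: "`1/ζ(s) ≪ log τ`" for `σ ≥ 1 − c/log τ`, in the abstract form

* **`ClassicalZFRData.norm_sub_one_div_le`** — there are `c > 0` and `C` with `G(s) ≠ 0` and
  `‖(s − 1)/G(s)‖ ≤ C log(|t| + 4)` whenever `1 − c/log(|t| + 4) ≤ σ ≤ 2` (for `G = (s − 1)ζ_K` this is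
  `|1/ζ_K(s)| ≤ C log(|t| + 4)`, the bound on the Dirichlet series `∑ μ(B)N(B)^{−s}` needed to move the
  contour in Möbius-sum estimates such as Heath-Brown's `Σ(x; C)`, Acta Math. 186 (2001), p. 51).

Proof (MV p. 174): with `σ₁ = 1 + c/log τ`, `log|G(σ₁ + it)| − log|G(σ + it)| = ∫_σ^{σ₁} Re(G'/G) ≤ (σ₁ − σ)·C₀log τ = O(1)`,
so `|G(s)| ≥ e^{−O(1)}|G(σ₁ + it)|`; and `|G(σ₁ + it)| ≥ c₁(σ₁ − 1)|σ₁ − 1 + it| ≥ c₁(c/log τ)|s − 1|`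
(`norm_apply_ge` of `ClassicalZeroFreeRegion.lean`, the lower bound slightly to the right of `σ = 1`).
The integration step is done through the elementary Grönwall-type lemma `norm_sq_le_norm_sq_mul_exp`:
if `‖F'‖ ≤ B‖F‖` on `[a, b]` then `‖F(b)‖² ≤ ‖F(a)‖²e^{2B(b−a)}` (`u ↦ ‖F(u)‖²e^{−2Bu}` is non-increasing).

## References

* H. L. Montgomery, R. C. Vaughan, *Multiplicative Number Theory I. Classical Theory*, Cambridge
  Stud. Adv. Math. 97 (2007), §6.1 Theorem 6.7. [cite: MontgomeryVaughan2007, Theorem 6.7]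

## Mathlib / tree search

Mathlib: `HasDerivAt.norm_sq`, `real_inner_le_norm`, `antitoneOn_of_hasDerivWithinAt_nonpos`,
`HasDerivAt.comp`, `HasDerivAt.ofReal_comp`, `Complex.sq_norm`. Tree: `ClassicalZeroFreeRegion`
(`ClassicalZFRData`, `norm_logDeriv_le`, `norm_apply_ge`, `one_le_log_tau`, `isOpen_dom`); the `ℚ`-case
bound `1/ζ ≪ log(|t| + 3)` exists separately as `ZetaClassicalRegion.exists_zeroFreeRegion_bounds`
(`ZetaClassicalRegionBounds.lean`, from Titchmarsh (3.11.8)), not for abstract `G`/`ζ_K`.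
-/

noncomputable section

open Complex Filter Topology Metric Set

namespace Literature.NumberTheory.LFunctions

/-! ### A Grönwall-type lower bound along a segment -/

/-- If `F : ℝ → ℂ` is differentiable on `[a, b]` with `‖F'(u)‖ ≤ B‖F(u)‖`, then
`‖F(b)‖² ≤ ‖F(a)‖² · e^{2B(b − a)}` — i.e. `‖F(a)‖ ≥ ‖F(b)‖e^{−B(b−a)}`: the function
`u ↦ ‖F(u)‖²e^{−2Bu}` is non-increasing, since `(‖F‖²)' = 2⟪F, F'⟫ ≤ 2B‖F‖²`. [folklore] -/
theorem norm_sq_le_norm_sq_mul_exp {F F' : ℝ → ℂ} {a b B : ℝ} (hab : a ≤ b)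
    (hF : ∀ u ∈ Icc a b, HasDerivAt F (F' u) u) (hbound : ∀ u ∈ Icc a b, ‖F' u‖ ≤ B * ‖F u‖) :
    ‖F b‖ ^ 2 ≤ ‖F a‖ ^ 2 * Real.exp (2 * B * (b - a)) := by
  -- `ψ(u) = ‖F u‖² e^{−2Bu}` is antitone on `[a, b]`
  set ψ : ℝ → ℝ := fun u => ‖F u‖ ^ 2 * Real.exp (-(2 * B * u)) with hψ
  have hderiv : ∀ u ∈ Icc a b, HasDerivAt ψ
      ((2 * (@inner ℝ ℂ _ (F u) (F' u))) * Real.exp (-(2 * B * u)) +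
        ‖F u‖ ^ 2 * (Real.exp (-(2 * B * u)) * (-(2 * B)))) u := by
    intro u hu
    have h1 : HasDerivAt (fun x => ‖F x‖ ^ 2) (2 * (@inner ℝ ℂ _ (F u) (F' u))) u := (hF u hu).norm_sq
    have h2 : HasDerivAt (fun x => Real.exp (-(2 * B * x))) (Real.exp (-(2 * B * u)) * (-(2 * B))) u := by
      have h0 : HasDerivAt (fun x : ℝ => x * (-(2 * B))) (-(2 * B)) u := by
        simpa using (hasDerivAt_id u).mul_const (-(2 * B))
      have : HasDerivAt (fun x => -(2 * B * x)) (-(2 * B)) u := by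
        convert h0 using 1; funext x; ring
      exact this.exp
    exact h1.mul h2
  have hnonpos : ∀ u ∈ Icc a b,
      (2 * (@inner ℝ ℂ _ (F u) (F' u))) * Real.exp (-(2 * B * u)) +
        ‖F u‖ ^ 2 * (Real.exp (-(2 * B * u)) * (-(2 * B))) ≤ 0 := by
    intro u hu
    have hinner : (@inner ℝ ℂ _ (F u) (F' u)) ≤ ‖F u‖ * ‖F' u‖ := real_inner_le_norm _ _
    have hFb := hbound u hu
    have hexp : 0 < Real.exp (-(2 * B * u)) := Real.exp_pos _
    have : 2 * (@inner ℝ ℂ _ (F u) (F' u)) ≤ 2 * B * ‖F u‖ ^ 2 := by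
      calc 2 * (@inner ℝ ℂ _ (F u) (F' u)) ≤ 2 * (‖F u‖ * ‖F' u‖) := by linarith
        _ ≤ 2 * (‖F u‖ * (B * ‖F u‖)) := by gcongr
        _ = 2 * B * ‖F u‖ ^ 2 := by ring
    nlinarith [hexp, this, sq_nonneg ‖F u‖]
  have hanti : AntitoneOn ψ (Icc a b) := by
    refine antitoneOn_of_hasDerivWithinAt_nonpos (convex_Icc a b)
      (f' := fun u => (2 * (@inner ℝ ℂ _ (F u) (F' u))) * Real.exp (-(2 * B * u)) +
        ‖F u‖ ^ 2 * (Real.exp (-(2 * B * u)) * (-(2 * B))))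
      (fun u hu => (hderiv u hu).continuousAt.continuousWithinAt) (fun u hu => ?_) (fun u hu => ?_)
    · exact (hderiv u (interior_subset hu)).hasDerivWithinAt
    · exact hnonpos u (interior_subset hu)
  have h := hanti (left_mem_Icc.mpr hab) (right_mem_Icc.mpr hab) hab
  simp only [hψ] at h
  -- `‖F b‖² e^{−2Bb} ≤ ‖F a‖² e^{−2Ba}`
  have hea : 0 < Real.exp (-(2 * B * a)) := Real.exp_pos _
  have heb : 0 < Real.exp (-(2 * B * b)) := Real.exp_pos _
  calc ‖F b‖ ^ 2 = ‖F b‖ ^ 2 * Real.exp (-(2 * B * b)) * Real.exp (2 * B * b) := by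
        rw [mul_assoc, ← Real.exp_add]; simp
    _ ≤ ‖F a‖ ^ 2 * Real.exp (-(2 * B * a)) * Real.exp (2 * B * b) :=
        mul_le_mul_of_nonneg_right h (Real.exp_pos _).le
    _ = ‖F a‖ ^ 2 * Real.exp (2 * B * (b - a)) := by
        rw [mul_assoc, ← Real.exp_add]; ring_nf

/-! ### `‖(s − 1)/G(s)‖ ≪ log(|t| + 4)` in the classical region -/

namespace ClassicalZFRData

variable {Λ : ℕ → ℝ} {G : ℂ → ℂ} {η : ℝ}

/-- **`1/ζ ≪ log τ` in the classical region (Montgomery–Vaughan, Theorem 6.7, second estimate of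
(6.6))**, for an abstract pair `(Λ, G)` satisfying `ClassicalZFRData Λ G η` (`G(s) = (s − 1)ζ(s)` or
`(s − 1)ζ_K(s)`): there are `c > 0` and `C` such that `G(s) ≠ 0` and `‖(s − 1)/G(s)‖ ≤ C log(|t| + 4)`
whenever `1 − c/log(|t| + 4) ≤ σ ≤ 2`. Proof as in MV: with `σ₁ = 1 + c/log τ`, the bound
`G'/G ≪ log τ` (`norm_logDeriv_le`) integrated along `[σ, σ₁]` gives `|G(s)| ≥ e^{−O(1)}|G(σ₁ + it)|`
(`norm_sq_le_norm_sq_mul_exp`), while `|G(σ₁ + it)| ≥ c₁(σ₁ − 1)|σ₁ − 1 + it|` (`norm_apply_ge`) and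
`|s − 1| ≤ |σ₁ − 1 + it|`. [cite: MontgomeryVaughan2007, Theorem 6.7] -/
theorem norm_sub_one_div_le (h : ClassicalZFRData Λ G η) :
    ∃ c : ℝ, 0 < c ∧ ∃ C : ℝ, ∀ s : ℂ, 1 - c / Real.log (|s.im| + 4) ≤ s.re → s.re ≤ 2 →
      G s ≠ 0 ∧ ‖(s - 1) / G s‖ ≤ C * Real.log (|s.im| + 4) := by
  obtain ⟨c₀, hc₀, C₀, hC₀, hld⟩ := h.norm_logDeriv_le
  obtain ⟨c₁, hc₁, hge⟩ := h.norm_apply_ge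
  have hη := h.eta_pos
  have hη1 := h.eta_le_one
  set c : ℝ := min c₀ (η / 2) with hcdef
  have hcpos : 0 < c := lt_min hc₀ (by positivity)
  have hcc₀ : c ≤ c₀ := min_le_left _ _
  have hcη : c ≤ η / 2 := min_le_right _ _
  have hc12 : c ≤ 1 / 2 := by linarith
  set K : ℝ := Real.exp (2 * C₀ * c) / (c₁ * c) with hKdef
  have hK1 : 1 / (c₁ * c) ≤ K := by
    rw [hKdef]; exact div_le_div_of_nonneg_right (Real.one_le_exp (by positivity)) (by positivity)
  refine ⟨c, hcpos, K, fun s hσ hσ2 => ?_⟩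
  obtain ⟨ℓ, hℓ⟩ : ∃ ℓ : ℝ, ℓ = Real.log (|s.im| + 4) := ⟨_, rfl⟩
  have hℓ1 : 1 ≤ ℓ := hℓ ▸ one_le_log_tau s.im
  have hℓpos : 0 < ℓ := by linarith
  rw [← hℓ] at hσ ⊢
  have hcℓ : c / ℓ ≤ c := div_le_self hcpos.le hℓ1
  have hcℓpos : 0 < c / ℓ := by positivity
  obtain ⟨σ₁, hσ₁⟩ : ∃ σ₁ : ℝ, σ₁ = 1 + c / ℓ := ⟨_, rfl⟩
  -- points `u + ti`, `u ≥ σ`, are in the region of `norm_logDeriv_le`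
  have hre : ∀ u : ℝ, ((u : ℂ) + (s.im : ℂ) * I).re = u := fun u => by simp
  have him : ∀ u : ℝ, ((u : ℂ) + (s.im : ℂ) * I).im = s.im := fun u => by simp
  have hregion1 : ∀ u : ℝ, s.re ≤ u → 1 - η < ((u : ℂ) + (s.im : ℂ) * I).re := by
    intro u hu
    rw [hre]
    have : c / ℓ < η := by linarith
    linarith
  have hregion2 : ∀ u : ℝ, s.re ≤ u →
      1 - c₀ / Real.log (|((u : ℂ) + (s.im : ℂ) * I).im| + 4) ≤ ((u : ℂ) + (s.im : ℂ) * I).re := by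
    intro u hu
    rw [hre, him, ← hℓ]
    have : c / ℓ ≤ c₀ / ℓ := div_le_div_of_nonneg_right hcc₀ hℓpos.le
    linarith
  have hs_eq : ((s.re : ℂ) + (s.im : ℂ) * I) = s := Complex.ext (by simp) (by simp)
  -- `G s ≠ 0`
  have hGs : G s ≠ 0 := by
    have h1 := (hld _ (hregion1 s.re le_rfl) (hregion2 s.re le_rfl)).1
    rwa [hs_eq] at h1
  refine ⟨hGs, ?_⟩
  have hGs_pos : 0 < ‖G s‖ := norm_pos_iff.mpr hGs
  -- the comparison point `s₁ = σ₁ + it`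
  obtain ⟨s₁, hs₁⟩ : ∃ s₁ : ℂ, s₁ = (σ₁ : ℂ) + (s.im : ℂ) * I := ⟨_, rfl⟩
  have hs₁re : s₁.re = σ₁ := by rw [hs₁]; simp
  have hs₁im : s₁.im = s.im := by rw [hs₁]; simp
  have hσ₁gt : 1 < σ₁ := by rw [hσ₁]; linarith
  have hσ₁le : σ₁ ≤ 2 := by rw [hσ₁]; linarith
  have hGs₁ : c₁ * (c / ℓ) * ‖s₁ - 1‖ ≤ ‖G s₁‖ := by
    have h1 := hge s₁ (by rw [hs₁re]; exact hσ₁gt) (by rw [hs₁re]; exact hσ₁le)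
    rwa [hs₁re, hσ₁, add_sub_cancel_left] at h1
  -- `‖s − 1‖ ≤ ‖s₁ − 1‖` when `|σ − 1| ≤ σ₁ − 1`
  have hnorm_le : s.re ≤ σ₁ → ‖s - 1‖ ≤ ‖s₁ - 1‖ := by
    intro hle
    have h1 : ‖s - 1‖ ^ 2 = (s.re - 1) ^ 2 + s.im ^ 2 := by
      rw [Complex.sq_norm, Complex.normSq_apply]; simp; ring
    have h2 : ‖s₁ - 1‖ ^ 2 = (σ₁ - 1) ^ 2 + s.im ^ 2 := by
      rw [Complex.sq_norm, Complex.normSq_apply, Complex.sub_re, Complex.sub_im, hs₁re, hs₁im]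
      simp; ring
    have h3 : (s.re - 1) ^ 2 ≤ (σ₁ - 1) ^ 2 := by
      have hlo : -(σ₁ - 1) ≤ s.re - 1 := by rw [hσ₁]; linarith
      have hhi : s.re - 1 ≤ σ₁ - 1 := by linarith
      have h0 : 0 ≤ σ₁ - 1 := by linarith
      nlinarith
    exact (pow_le_pow_iff_left₀ (norm_nonneg _) (norm_nonneg _) two_ne_zero).mp (by linarith)
  by_cases hcase : s.re ≤ σ₁
  · -- Case A: integrate `G'/G` along `[σ, σ₁]`
    obtain ⟨F, hF⟩ : ∃ F : ℝ → ℂ, F = fun u : ℝ => G ((u : ℂ) + (s.im : ℂ) * I) := ⟨_, rfl⟩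
    obtain ⟨F', hF'⟩ : ∃ F' : ℝ → ℂ, F' = fun u : ℝ => deriv G ((u : ℂ) + (s.im : ℂ) * I) := ⟨_, rfl⟩
    have hFderiv : ∀ u ∈ Icc s.re σ₁, HasDerivAt F (F' u) u := by
      intro u hu
      have hz : DifferentiableAt ℂ G ((u : ℂ) + (s.im : ℂ) * I) :=
        h.differentiableOn.differentiableAt ((isOpen_dom η).mem_nhds (hregion1 u hu.1))
      have hinner : HasDerivAt (fun y : ℝ => ((y : ℂ) + (s.im : ℂ) * I)) 1 u := by
        simpa using ((hasDerivAt_id u).ofReal_comp).add_const ((s.im : ℂ) * I)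
      have hc := hz.hasDerivAt.comp u hinner
      rw [mul_one] at hc
      rw [hF, hF']
      exact hc
    have hFbound : ∀ u ∈ Icc s.re σ₁, ‖F' u‖ ≤ (C₀ * ℓ) * ‖F u‖ := by
      intro u hu
      obtain ⟨hne, hb⟩ := hld _ (hregion1 u hu.1) (hregion2 u hu.1)
      rw [him, ← hℓ, norm_div, div_le_iff₀ (norm_pos_iff.mpr hne)] at hb
      rw [hF, hF']
      exact hb
    have hgron := norm_sq_le_norm_sq_mul_exp hcase hFderiv hFbound
    have hFs : F s.re = G s := by rw [hF]; exact congrArg G hs_eq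
    have hFs₁ : F σ₁ = G s₁ := by rw [hF, hs₁]
    rw [hFs, hFs₁] at hgron
    have hexp_le : Real.exp (2 * (C₀ * ℓ) * (σ₁ - s.re)) ≤ Real.exp (2 * C₀ * c) ^ 2 := by
      have hsq : Real.exp (2 * C₀ * c) ^ 2 = Real.exp (2 * (2 * C₀ * c)) := by
        rw [sq, ← Real.exp_add]; ring_nf
      rw [hsq]
      apply Real.exp_le_exp.mpr
      have hdiff : σ₁ - s.re ≤ 2 * (c / ℓ) := by rw [hσ₁]; linarith
      have h1 : 2 * (C₀ * ℓ) * (σ₁ - s.re) ≤ 2 * (C₀ * ℓ) * (2 * (c / ℓ)) :=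
        mul_le_mul_of_nonneg_left hdiff (by positivity)
      have heq : 2 * (C₀ * ℓ) * (2 * (c / ℓ)) = 2 * (2 * C₀ * c) := by
        field_simp
      linarith [heq]
    -- `‖G s₁‖ ≤ ‖G s‖ · e^{2C₀c}`
    have hGsGs₁ : ‖G s₁‖ ≤ ‖G s‖ * Real.exp (2 * C₀ * c) := by
      have h1 : ‖G s₁‖ ^ 2 ≤ (‖G s‖ * Real.exp (2 * C₀ * c)) ^ 2 := by
        rw [mul_pow]
        exact hgron.trans (mul_le_mul_of_nonneg_left hexp_le (sq_nonneg _))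
      exact (pow_le_pow_iff_left₀ (norm_nonneg _) (by positivity) two_ne_zero).mp h1
    rw [norm_div, div_le_iff₀ hGs_pos]
    have hsn := hnorm_le hcase
    have hstep : ‖s₁ - 1‖ ≤ ‖G s₁‖ * (ℓ / (c₁ * c)) := by
      have h1 : ‖s₁ - 1‖ ≤ ‖G s₁‖ / (c₁ * (c / ℓ)) := by
        rw [le_div_iff₀ (by positivity)]
        calc ‖s₁ - 1‖ * (c₁ * (c / ℓ)) = c₁ * (c / ℓ) * ‖s₁ - 1‖ := by ring
          _ ≤ ‖G s₁‖ := hGs₁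
      have h2 : ‖G s₁‖ / (c₁ * (c / ℓ)) = ‖G s₁‖ * (ℓ / (c₁ * c)) := by
        field_simp
      rwa [h2] at h1
    calc ‖s - 1‖ ≤ ‖s₁ - 1‖ := hsn
      _ ≤ ‖G s₁‖ * (ℓ / (c₁ * c)) := hstep
      _ ≤ ‖G s‖ * Real.exp (2 * C₀ * c) * (ℓ / (c₁ * c)) :=
          mul_le_mul_of_nonneg_right hGsGs₁ (by positivity)
      _ = K * ℓ * ‖G s‖ := by rw [hKdef]; field_simp
  · -- Case B: `σ₁ < σ ≤ 2`, directly from `norm_apply_ge`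
    have hσgt : σ₁ < s.re := lt_of_not_ge hcase
    have h1σ : 1 < s.re := hσ₁gt.trans hσgt
    have hG := hge s h1σ hσ2
    rw [norm_div, div_le_iff₀ hGs_pos]
    have hσc : c / ℓ < s.re - 1 := by rw [hσ₁] at hσgt; linarith
    have h2 : ‖s - 1‖ * (c₁ * (c / ℓ)) ≤ ‖G s‖ := by
      calc ‖s - 1‖ * (c₁ * (c / ℓ)) ≤ ‖s - 1‖ * (c₁ * (s.re - 1)) :=
            mul_le_mul_of_nonneg_left (mul_le_mul_of_nonneg_left hσc.le hc₁.le) (norm_nonneg _)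
        _ = c₁ * (s.re - 1) * ‖s - 1‖ := by ring
        _ ≤ ‖G s‖ := hG
    calc ‖s - 1‖ = ‖s - 1‖ * (c₁ * (c / ℓ)) * (ℓ * (1 / (c₁ * c))) := by field_simp
      _ ≤ ‖G s‖ * (ℓ * (1 / (c₁ * c))) := mul_le_mul_of_nonneg_right h2 (by positivity)
      _ ≤ ‖G s‖ * (ℓ * K) := by
          refine mul_le_mul_of_nonneg_left (mul_le_mul_of_nonneg_left hK1 hℓpos.le) hGs_pos.le
      _ = K * ℓ * ‖G s‖ := by ring

end ClassicalZFRData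

end Literature.NumberTheory.LFunctions

end
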